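import Literature.Geometry.Kaehler.ComplexTorusSiegelRiemannForm
import HarnessLib

/-!
# `E_Ω(v, iv) = -H_Ω(v, v)`: the diagonal values of the Siegel Riemann form

Layer `Literature/Geometry/Kaehler`, namespace `Literature.Geometry.Kaehler.ComplexTorus`; lane
`lit-hodgefound`, prover seat `lit-hodgefound-p07`, generation 19 — rider towards FILE C (torus glue)
of the programme «`[Θ_Ω] = -E_Ω` for every `Ω ∈ 𝔥_g`»: the value of the Riemann form
`E_Ω = Im H_Ω` (the tree's `siegelTwoForm d Φ`) on a pair `(v, iv)` is minus the hermitian form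
`H_Ω(v, v) = ᵗ(Im v)(Im Ω)⁻¹(Im v) + ᵗ(Re v)(Im Ω)⁻¹(Re v)` — the quantity that the line Laplacian of
the metric exponent `q = ᵗ(Im z)(Im Ω)⁻¹(Im z)` produces (`LineLaplacianQuadraticForm.lean`:
`Δ_v q = 2[ᵗ(Im v)Y⁻¹(Im v) + ᵗ(Re v)Y⁻¹(Re v)]`, as `Im(iv) = Re v`). Lange–Birkenhake, Lemma 1.2.10:
`E(v, w) = Im H(v, w)` and `H(v, w) = E(iv, w) + iE(v, w)`, so `E(v, iv) = -E(iv, v) = -H(v, v)`.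

Theorems only; no definitions, no named facts.

## References

* [LangeBirkenhake1992] H. Lange, Ch. Birkenhake, *Complex Abelian Varieties*, Springer (1992),
  Lemma 1.2.10 p. 26 (`E = Im H`, `H(v,w) = E(iv, w) + iE(v, w)`).
* [Lange2023AbelianVarietiesComplex] H. Lange, *Abelian Varieties over the Complex Numbers* (2023),
  §3.3.4 Exercise (4) (the Siegel period matrix and its Riemann form).
-/

noncomputable section

open Complex Matrix

namespace Literature.Geometry.Kaehler

namespace ComplexTorus

variable {n : ℕ} (Ω : Matrix (Fin n) (Fin n) ℂ) (d : Fin n → ℕ)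
  (Φ : (Fin n ⊕ Fin n → ℝ) ≃L[ℝ] (Fin n → ℂ))

/-- **`E_Ω(v, iv) = -(ᵗ(Im v)(Im Ω)⁻¹(Im v) + ᵗ(Re v)(Im Ω)⁻¹(Re v)) = -H_Ω(v, v)`** for the Siegel
Riemann form of type `D` (`Ω` symmetric, `Im Ω ≻ 0`). [cite: LangeBirkenhake1992, Lemma 1.2.10;
Lange2023AbelianVarietiesComplex, §3.3.4 Exercise (4)] -/
theorem siegelTwoForm_apply_self_I_smul
    (hΦ : ∀ v i, Φ v i = (d i : ℂ) * (v (Sum.inl i) : ℂ) + ∑ j, Ω i j * (v (Sum.inr j) : ℂ))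
    (hΩ : ∀ i j, Ω i j = Ω j i) (hpos : (Matrix.of fun i j => (Ω i j).im).PosDef) (v : Fin n → ℂ) :
    siegelTwoForm d Φ ![v, I • v] =
      -((fun i => (v i).im) ⬝ᵥ (siegelImInv Ω *ᵥ fun i => (v i).im) +
        (fun i => (v i).re) ⬝ᵥ (siegelImInv Ω *ᵥ fun i => (v i).re)) := by
  rw [siegelTwoForm_apply Ω d Φ hΦ hΩ hpos v (I • v)]
  have hre : (fun j => ((I • v) j).re) = -fun j => (v j).im := by
    funext j; simp
  have him : (fun j => ((I • v) j).im) = fun j => (v j).re := by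
    funext j; simp
  rw [hre, him, Matrix.mulVec_neg, dotProduct_neg]
  ring

/-- The same value is non-positive: `E_Ω(v, iv) ≤ 0`, i.e. `H_Ω(v, v) ≥ 0` (`(Im Ω)⁻¹ ≻ 0`).
[cite: LangeBirkenhake1992, Lemma 1.2.10; Lange2023AbelianVarietiesComplex, §3.3.4 Exercise (4)] -/
theorem siegelTwoForm_apply_self_I_smul_nonpos
    (hΦ : ∀ v i, Φ v i = (d i : ℂ) * (v (Sum.inl i) : ℂ) + ∑ j, Ω i j * (v (Sum.inr j) : ℂ))
    (hΩ : ∀ i j, Ω i j = Ω j i) (hpos : (Matrix.of fun i j => (Ω i j).im).PosDef) (v : Fin n → ℂ) :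
    siegelTwoForm d Φ ![v, I • v] ≤ 0 := by
  rw [siegelTwoForm_apply_self_I_smul Ω d Φ hΦ hΩ hpos v, neg_nonpos]
  have hW := (posDef_siegelImInv Ω hpos).posSemidef
  exact add_nonneg (hW.dotProduct_mulVec_nonneg _) (hW.dotProduct_mulVec_nonneg _)

end ComplexTorus

end Literature.Geometry.Kaehler
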